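import Literature.Analysis.ValidatedNumerics.SymInertiaCertificate
import Literature.Analysis.ValidatedNumerics.ParametricEigenScan
import HarnessLib

/-!
# Certified eigenvalue-count WINDOWS (spectral gaps) of a parametric symmetric family over a box:
# a kd-tree of leaves, each carrying two kernel-checked inertia certificates

Topic `Literature/Analysis/ValidatedNumerics`. The parametric layer over
`SymInertiaCertificate.lean` (the per-family count checker `checkInertia`), in the format of
`MatrixEigenEnclosure.lean` § "Parametric families over a box" / `ParametricEigenScan.lean`: a
kd-tree (`BoxCover.KdCert`) over the parameter box whose leaves carry an entrywise enclosure `C ± Δ`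
of the family on the leaf box and TWO inertia certificates for that interval family, at the window
ends `a ≤ b`, with one common count `ν`. If the tree passes `KdCert.check (inertiaLeafOK n entryOK a
b ν)` — every leaf's entry enclosure is confirmed by the user-supplied check `entryOK` (for `RExpr`
entry tables: `rexprEntryOK`, interval re-evaluation in the kernel) and both certificates pass
`checkInertia` — then for EVERY parameter `k` of the box the symmetric matrix `A k` has exactly `ν`
eigenvalues `< a` and none in `[a, b]` (`card_eigenvalues_window_on_box_of_kdCheck`; `RExpr`
instantiation `card_eigenvalues_window_rexprMatrix_of_kdCheck`). In words: a certified spectral gap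
`λ_ν(k) < a ≤ b < λ_{ν+1}(k)` (ascending enumeration) uniformly on the box — the kernel statement an
emitted "window scan" certificate instantiates END-TO-END (the certificate term is data; `decide`
re-runs every entry enclosure and every exact `LDLᵀ` identity).

The mathematics per leaf is Golub–Van Loan §8.4.2 (spectrum slicing by Sylvester inertia) with
Weyl's bound for the interval family, proved in
`Literature/LinearAlgebra/Matrix/SylvesterInertiaLDL.lean` and packaged as `checkInertia` soundness
in `SymInertiaCertificate.lean`; the box-to-leaves step is `KdCert.sound` of `BoxCover.lean`.
Nothing here is new mathematics; it is certificate plumbing.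

## What is NOT certified

Nothing off the box; nothing about which eigenvalues beyond the count (no values, no vectors);
nothing for non-symmetric members; nothing about an operator the family discretises; an emitted tree
that fails the check proves nothing.

## References

* [GolubVanLoan2013] G. H. Golub, C. F. Van Loan, *Matrix Computations*, 4th ed. (2013),
  §8.4.1–§8.4.2.
-/

open Finset Matrix

namespace Literature.Analysis.ValidatedNumerics

/-! ### Parametric families over a box: eigenvalue-count WINDOWS by a kd-tree of inertia leaves -/

section Parametric

variable {β : Type}

/-- Leaf datum for a parametric real symmetric family over a box: entrywise enclosure data `C ± Δ`
valid on the leaf box, TWO inertia certificates (at the window ends `a` and `b`) for that interval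
family, and auxiliary data for the user-supplied entry-enclosure check.
[cite: GolubVanLoan2013, §8.4.2 (p. 466), two shifted factorisations per leaf] -/
structure InertiaLeaf (β : Type) where
  /-- centre of the entries on the leaf box -/
  C : List (List ℚ)
  /-- radii of the entries on the leaf box -/
  Δ : List (List ℚ)
  /-- inertia certificate at the lower window end `a` -/
  certA : InertiaCert
  /-- inertia certificate at the upper window end `b` -/
  certB : InertiaCert
  /-- data for the entry-enclosure check -/
  aux : β

/-- The entry-enclosure view of an inertia leaf (same `C`, `Δ`, `aux`; the `LDLCert` slot is a
dummy): lets the entry checks written for `SymLeaf` (e.g. `rexprEntryOK`) be reused (plumbing).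
[folklore] -/
def InertiaLeaf.toSymLeaf (l : InertiaLeaf β) : SymLeaf β := ⟨l.C, l.Δ, default, l.aux⟩

/-- Leaf check of a count window: the user's entry-enclosure check, the two certificates sit at the
window ends `a`, `b` with the common count `ν`, and both pass `checkInertia`.
[cite: GolubVanLoan2013, §8.4.2 (p. 466); §8.4.1] -/
def inertiaLeafOK (n : ℕ) (entryOK : Box → SymLeaf β → Bool) (a b : ℚ) (ν : ℕ) (B : Box)
    (l : InertiaLeaf β) : Bool :=
  entryOK B l.toSymLeaf && decide (l.certA.c = a) && decide (l.certB.c = b) &&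
    decide (l.certA.ν = ν) && decide (l.certB.ν = ν) &&
    checkInertia n l.C l.Δ l.certA && checkInertia n l.C l.Δ l.certB

/-- **Uniform eigenvalue-count window of a real symmetric family over a box (Golub–Van Loan §8.4.2
leafwise).** Let `A k` be symmetric for every parameter `k`, and let `entryOK B l = true` guarantee
`|A k i j − C i j| ≤ Δ i j` for all `k ∈ B`. If a kd-tree of inertia leaves passes
`KdCert.check (inertiaLeafOK n entryOK a b ν)` on the box `B` (`a ≤ b`), then for EVERY `k ∈ B` the
matrix `A k` has exactly `ν` eigenvalues `< a` and NO eigenvalue in the closed window `[a, b]` — a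
certified spectral gap, uniformly on the box. [cite: GolubVanLoan2013, §8.4.2 (p. 466); §8.4.1] -/
theorem card_eigenvalues_window_on_box_of_kdCheck {n : ℕ} {A : (ℕ → ℝ) → Matrix (Fin n) (Fin n) ℝ}
    (hA : ∀ k, (A k).IsHermitian) {entryOK : Box → SymLeaf β → Bool}
    (hentry : ∀ B l, entryOK B l = true → ∀ k, B.mem k →
      ∀ i j : Fin n, |A k i j - mreal l.C i j| ≤ mreal l.Δ i j)
    {a b : ℚ} (hab : a ≤ b) {ν : ℕ} {B : Box} {t : KdCert (InertiaLeaf β)}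
    (h : t.check (inertiaLeafOK n entryOK a b ν) B = true) (k : ℕ → ℝ) (hk : B.mem k) :
    #{i | (hA k).eigenvalues i < a} = ν ∧ ∀ i, (hA k).eigenvalues i ∉ Set.Icc (a : ℝ) (b : ℝ) := by
  refine KdCert.sound (P := fun k ↦ #{i | (hA k).eigenvalues i < a} = ν ∧
      ∀ i, (hA k).eigenvalues i ∉ Set.Icc (a : ℝ) (b : ℝ)) (fun B l hl k hk ↦ ?_) t B h k hk
  simp only [inertiaLeafOK, Bool.and_eq_true, decide_eq_true_eq] at hl
  obtain ⟨⟨⟨⟨⟨⟨h1, h2⟩, h3⟩, h4⟩, h5⟩, h6⟩, h7⟩ := hl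
  have hΔ : ∀ i j : Fin n, |A k i j - mreal l.C i j| ≤ mreal l.Δ i j := hentry B _ h1 k hk
  refine ⟨?_, ?_⟩
  · have := (card_eigenvalues_lt_eq_of_checkInertia h6 (hA k) hΔ).1
    rw [h2, h4] at this
    exact this
  · have hw := forall_eigenvalues_not_mem_Icc_of_checkInertia h6 h7 (by rw [h2, h3]; exact hab)
      (by rw [h4, h5]) (hA k) hΔ
    rw [h2, h3] at hw
    exact hw

/-- **Certified eigenvalue-count window (real symmetric `RExpr` family).** If every
`A k = rexprMatrix n E k` is symmetric and a kd-tree of inertia leaves passes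
`KdCert.check (inertiaLeafOK n (rexprEntryOK n E ∘ …) a b ν)` on the box `B`, then every `A k`,
`k ∈ B`, has exactly `ν` eigenvalues `< a` and none in `[a, b]` — the END-TO-END kernel statement
of a certified gap scan (entry enclosures re-evaluated by `RExpr.enclose` on every leaf).
[cite: GolubVanLoan2013, §8.4.2 (p. 466); §8.4.1] -/
theorem card_eigenvalues_window_rexprMatrix_of_kdCheck {n : ℕ} {E : List (List RExpr)}
    (hsymm : ∀ k, (rexprMatrix n E k).IsHermitian) {a b : ℚ} (hab : a ≤ b) {ν : ℕ} {B : Box}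
    {t : KdCert (InertiaLeaf (ℕ × ℕ))}
    (h : t.check (inertiaLeafOK n (rexprEntryOK n E) a b ν) B = true) (k : ℕ → ℝ) (hk : B.mem k) :
    #{i | (hsymm k).eigenvalues i < a} = ν ∧
      ∀ i, (hsymm k).eigenvalues i ∉ Set.Icc (a : ℝ) (b : ℝ) :=
  card_eigenvalues_window_on_box_of_kdCheck hsymm
    (fun _ l hl k hk i j ↦ rexprEntryOK_sound (l := l) hl k hk i j) hab h k hk

end Parametric


end Literature.Analysis.ValidatedNumerics
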